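/-
Copyright (c) 2026 the pub-hodgecm-mathlib formalisation cell (harness21).  Prover seat hodgecm-mathlib-LA3-p01 (g2), «GO 500» half A line L3 (socket `stub_FROB`),
organ (ν8h) «ROOF-LEG REDUCTION THROUGH A POST-COMPOSITE» for the (ρ-𝔟) road of `stub_ROOF0` (LA3-plan (g0) RULINGS #5–#7; LA3-p01 (g2) census 2026-09-02T05:33Z); 2026-09-02.
-/
import Literature.AlgebraicGeometry.AbelianSchemes.AbelianSchemeHomReductionSpecialFibre
import HarnessLib

/-!
# REDUCTION OF A HOMOMORPHISM BETWEEN FIBRE TUPLES — THE SPECIAL FIBRE OF A POST-COMPOSITE WITH A MODEL HOMOMORPHISM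
# (`red(u ≫ h_{x″}) = red(u) ≫ h_{x̄″}` for `h : 𝒞 → ℰ` over the model, and the polarisation law it carries; [SerreTate1968] §1, [BoschLutkebohmertRaynaud1990] §1.2 Prop. 8)

Topic `AlgebraicGeometry/AbelianSchemes`, namespace `Literature.AlgebraicGeometry.AbelianSchemes.AbelianSchemeOver`.  THEOREMS ONLY (no definition, no named
fact, no instance, no notation).  Cell `hodgecm-mathlib` (D-0151), F0∕P6 «MOD», organ **(ν8h)**: the head of ★ (ν8) `exists_specialFibre_hom_reduction` VERBATIM — the
special fibre `ū : (𝒜_s)_{x̄} → (𝒞_s)_{x̄″}` of a homomorphism `u : (𝒜_η)_x → (𝒞_η)_{x″}` with its four transfers (i)–(iv) — PLUS a fifth transfer **(iv-h)**: for every abelian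
scheme `ℰ → 𝓨` and every homomorphism `h : 𝒞 → ℰ` OVER THE MODEL `𝓨`, with polarisations `λ_𝒜`, `λ_ℰ` (NO dual pair of `𝒞` is asked), if the post-composite
`u₂ := u ≫ h_{x″}` satisfies `u₂ ≫ (λ_ℰ)_{x″} ≫ u₂^∨ = (λ_𝒜)_x ≫ [n]` then `w := ū ≫ h_{x̄″}` satisfies `w ≫ (λ_ℰ)_{x̄″} ≫ w^∨ = (λ_𝒜)_{x̄} ≫ [n]` — THE SAME `ū`.

WHY (consumer: the D-line `stub_FROB` ROOF road, row (r3₀-q) of `Roof₀` under the (ρ-𝔟) road of record): ★ (ν8)(iv) transports polarisation laws of the TARGET FAMILY `𝒞`;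
for the retargeted roof leg `q′ : 𝒜_x → 𝒞_{x″}` into the Serre family `𝒞 = 𝒜 ⊗ 𝔟` a model-level dual pair of `𝒞` is not in the tree, but the Serre cover `ψ′ : 𝒞 → 𝒜`
(`ψ_P ≫ ψ′ = [N]`) is: the law of `q′ ≫ ψ′_{x″}` is a law between `𝒜`-fibres with `𝒜`'s own polarisation on both sides, it transfers by (iv-h), and downstairs `q̄^*λ_B̄`
is recovered from `(q̄ ≫ ψ′_{x̄″})^*λ_{x̄″}` by cancelling `ψ_P` (★ `RoofLegsSpecialFibre` bookkeeping).

ROAD.  ONE turnkey (★ (ν7)) for `u`; the stage homomorphism `U ≫ h_{V′}` has `Ω`-fibre `u₂` and special fibre `ū ≫ h_{x̄″}` through the five-piece along-stage isomorphisms —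
both by their NATURALITY in the abelian scheme (★ (ν6) §1 `fibreHom_comp_alongStageIso_hom` at `h`) — and ★ (ν8) §1 `specialFibre_comp_lam_comp_dualIsogenyOver_eq_of_generic`
applies to it at the families `(𝒜, ℰ)`.  No uniqueness-of-reduction theory, no product families.  §1 the abstract two-stage statement; §2 the head.

HONEST LABEL: HC_CM is proved only modulo the cell's 2 remaining named inputs (hLiu418 24832, h413 24833) until rung 0 closes; generic capital on
`--supports stmt-HodgeConjecture-24832`, pays no letter.

## References
* [SerreTate1968] J.-P. Serre, J. Tate, *Good reduction of abelian varieties*, Ann. of Math. 88 (1968), §1 (Lemma 2, Theorem 1).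
* [BoschLutkebohmertRaynaud1990] S. Bosch, W. Lütkebohmert, M. Raynaud, *Néron Models* (1990), §1.2 Prop. 8, §7.3 Prop. 6 (p. 180).
* [MumfordFogartyKirwan1994] D. Mumford, J. Fogarty, F. Kirwan, *GIT*, 3rd ed., Ch. 6 §1 Cor. 6.2 (p. 116), Cor. 6.8 (p. 118), Ch. 7 §2 Def. 7.1–7.2 (p. 129).
* [MumfordAV1970] D. Mumford, *Abelian Varieties* (1970), §15 Thm. 1 (p. 143).
* [EGAIV3] A. Grothendieck, J. Dieudonné, EGA IV₃ (1966), 11.10.5.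
-/

set_option autoImplicit false

noncomputable section

set_option backward.isDefEq.respectTransparency false

open CategoryTheory CategoryTheory.Limits AlgebraicGeometry
open scoped MonObj CategoryTheory.Obj NumberField
open Literature.AlgebraicGeometry.Motives
open IsDedekindDomain IsDedekindDomain.HeightOneSpectrum ValuativeRel
open Literature.NumberTheory.EllipticCurves (genericFibre specGenericPoint)
open Literature.NumberTheory.GaloisRepresentations (closureValuationSubring)
open Literature.NumberTheory.DiophantineGeometry

namespace Literature.AlgebraicGeometry.AbelianSchemes

namespace AbelianSchemeOver

universe u

section Bookkeeping

/-- Composition of morphisms of abelian varieties, read on the underlying group-scheme morphisms. [folklore] -/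
private theorem av_comp_hom_hom_hom' {k : Type u} [Field k] {X Y Z : AbelianVariety k} (φ : X ⟶ Y) (ψ : Y ⟶ Z) :
    (φ ≫ ψ).hom.hom.hom = φ.hom.hom.hom ≫ ψ.hom.hom.hom := rfl

end Bookkeeping

section AbstractComp

/-! ### §1 The abstract two-stage setting of ★ (ν8) §1: the post-composite `U ≫ h_{V′}` has `Ω`-fibre `u ≫ h_{y″}` and special fibre `ū ≫ h_{ys″}`; its polarisation law transfers -/

variable {T Ug V V' Us : Scheme.{u}} {Ω κ : Type u} [Field Ω] [Field κ]
  (j : Ug ⟶ T) (z z'' : V ⟶ T) (g : V' ⟶ V) (y y'' : Spec (.of Ω) ⟶ Ug) (a : Spec (.of Ω) ⟶ V) (a' : Spec (.of Ω) ⟶ V')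
  (hpt : y ≫ j = a ≫ z) (hpt'' : y'' ≫ j = a ≫ z'') (e : a' ≫ g = a)
  (js : Us ⟶ T) (ys ys'' : Spec (.of κ) ⟶ Us) (b : Spec (.of κ) ⟶ V) (b' : Spec (.of κ) ⟶ V')
  (hspt : ys ≫ js = b ≫ z) (hspt'' : ys'' ≫ js = b ≫ z'') (es : b' ≫ g = b)
  (𝒜 𝒞 : AbelianSchemeOver T)
  (U : ((𝒜.baseChange z).baseChange g).X ⟶ ((𝒞.baseChange z'').baseChange g).X) [IsMonHom U]
  (u : ((𝒜.baseChange j).baseChange y).X ⟶ ((𝒞.baseChange j).baseChange y'').X) [IsMonHom u]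
  [QuasiCompact a'] [IsSchemeTheoreticallyDominant a']
  (hfib : fibreHom U a' =
    (𝒜.fibreBaseChangeIso j y ≪≫ 𝒜.fibreCongrPtIso hpt ≪≫ (𝒜.fibreBaseChangeIso z a).symm ≪≫
        ((𝒜.baseChange z).fibreCongrPtIso e).symm ≪≫ ((𝒜.baseChange z).fibreBaseChangeIso g a').symm).inv ≫ homOfIsMonHom u ≫
      (𝒞.fibreBaseChangeIso j y'' ≪≫ 𝒞.fibreCongrPtIso hpt'' ≪≫ (𝒞.fibreBaseChangeIso z'' a).symm ≪≫
        ((𝒞.baseChange z'').fibreCongrPtIso e).symm ≪≫ ((𝒞.baseChange z'').fibreBaseChangeIso g a').symm).hom)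

omit [QuasiCompact a'] [IsSchemeTheoreticallyDominant a'] in
include hfib in
set_option maxHeartbeats 400000 in
/-- **THE POLARISATION LAW OF A POST-COMPOSITE TRANSFERS FROM THE GENERIC TO THE SPECIAL FIBRE.**  Abstract two-stage setting of ★ (ν8) §1 (`U` a stage homomorphism
whose `a′`-fibre is `u` through the generic five-piece isomorphisms, `hfib`; stage `V′` connected, reduced, locally Noetherian), plus a homomorphism `h : 𝒞 → ℰ` of abelian
schemes OVER `T` (a MODEL homomorphism) and `u₂ = u ≫ (h ×_T U_g)_{y″}`.  The stage homomorphism `U ≫ ((h ×_T V) ×_V V′)` has `a′`-fibre `u₂` (naturality of the generic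
five-piece isomorphisms, ★ (ν6) §1 `fibreHom_comp_alongStageIso_hom`) and its special fibre read through the special five-piece isomorphisms IS `ū ≫ (h ×_T U_s)_{ys″}`
(the same naturality at the special point) — so ★ (ν8) §1 `specialFibre_comp_lam_comp_dualIsogenyOver_eq_of_generic` at the families `(𝒜, ℰ)`: if
`u₂ ≫ (λ_ℰ)_{y″} ≫ u₂^∨ = (λ_𝒜)_y ≫ [n]` then `w ≫ (λ_ℰ)_{ys″} ≫ w^∨ = (λ_𝒜)_{ys} ≫ [n]` for `w = ū ≫ (h ×_T U_s)_{ys″}`.  (No dual pair of `𝒞` is needed: the law is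
transported through `𝒜` and `ℰ` only.) [cite: MumfordFogartyKirwan1994, Ch. 6 §1 Corollary 6.2 (p. 116) and Corollary 6.8 (p. 118); Ch. 7 §2 Definition 7.2 (p. 129)]
[cite: MumfordAV1970, §15 Thm. 1 (p. 143)] [cite: EGAIV3, 11.10.5] -/
theorem specialFibre_postcomp_comp_lam_comp_dualIsogenyOver_eq_of_generic [IsLocallyNoetherian V'] [PreconnectedSpace V'] [IsReduced V']
    (ℰ : AbelianSchemeOver T) (h : 𝒞.X ⟶ ℰ.X) [IsMonHom h]
    (D𝒜 : 𝒜.DualPair) (pol𝒜 : 𝒜.Polarization D𝒜) (Dℰ : ℰ.DualPair) (polℰ : ℰ.Polarization Dℰ) (n : ℕ)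
    (u₂ : ((𝒜.baseChange j).baseChange y).X ⟶ ((ℰ.baseChange j).baseChange y'').X) [IsMonHom u₂]
    (hu₂ : u₂ = u ≫ baseChangeHom (baseChangeHom h j) y'')
    (hlam : u₂ ≫ ((polℰ.baseChange j).baseChange y'').lam ≫
        DualPair.dualIsogenyOver u₂ ((D𝒜.baseChange j).baseChange y) ((Dℰ.baseChange j).baseChange y'') =
      ((pol𝒜.baseChange j).baseChange y).lam ≫ ((D𝒜.baseChange j).baseChange y).hat.mulN n)
    (w : ((𝒜.baseChange js).baseChange ys).X ⟶ ((ℰ.baseChange js).baseChange ys'').X) [IsMonHom w]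
    (hw : w = ((𝒜.fibreBaseChangeIso js ys ≪≫ 𝒜.fibreCongrPtIso hspt ≪≫ (𝒜.fibreBaseChangeIso z b).symm ≪≫ ((𝒜.baseChange z).fibreCongrPtIso es).symm ≪≫ ((𝒜.baseChange z).fibreBaseChangeIso g b').symm).hom ≫ fibreHom U b' ≫ (𝒞.fibreBaseChangeIso js ys'' ≪≫ 𝒞.fibreCongrPtIso hspt'' ≪≫ (𝒞.fibreBaseChangeIso z'' b).symm ≪≫ ((𝒞.baseChange z'').fibreCongrPtIso es).symm ≪≫ ((𝒞.baseChange z'').fibreBaseChangeIso g b').symm).inv).hom.hom.hom ≫ baseChangeHom (baseChangeHom h js) ys'') :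
    w ≫ ((polℰ.baseChange js).baseChange ys'').lam ≫ DualPair.dualIsogenyOver w ((D𝒜.baseChange js).baseChange ys) ((Dℰ.baseChange js).baseChange ys'') =
      ((pol𝒜.baseChange js).baseChange ys).lam ≫ ((D𝒜.baseChange js).baseChange ys).hat.mulN n := by
  haveI := isMonHom_baseChangeHom h j
  haveI := isMonHom_baseChangeHom (baseChangeHom h j) y''
  haveI := isMonHom_baseChangeHom h z''
  haveI := isMonHom_baseChangeHom (baseChangeHom h z'') g
  haveI := isMonHom_baseChangeHom h js
  haveI := isMonHom_baseChangeHom (baseChangeHom h js) ys''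
  -- `u₂` on abelian varieties
  have hu₂' : homOfIsMonHom u₂ = homOfIsMonHom u ≫ fibreHom (baseChangeHom h j) y'' :=
    AbelianVariety.hom_ext _ _ (by simp only [av_comp_hom_hom_hom', homOfIsMonHom_hom, fibreHom_hom_hom_hom]; exact hu₂)
  -- Step 1: the `a′`-fibre of the post-composite stage homomorphism is `u₂` (naturality of the generic five-piece isomorphisms, ★ (ν6) §1)
  have hfib₂ : fibreHom (U ≫ baseChangeHom (baseChangeHom h z'') g) a' =
      (𝒜.fibreBaseChangeIso j y ≪≫ 𝒜.fibreCongrPtIso hpt ≪≫ (𝒜.fibreBaseChangeIso z a).symm ≪≫ ((𝒜.baseChange z).fibreCongrPtIso e).symm ≪≫ ((𝒜.baseChange z).fibreBaseChangeIso g a').symm).inv ≫ homOfIsMonHom u₂ ≫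
        (ℰ.fibreBaseChangeIso j y'' ≪≫ ℰ.fibreCongrPtIso hpt'' ≪≫ (ℰ.fibreBaseChangeIso z'' a).symm ≪≫ ((ℰ.baseChange z'').fibreCongrPtIso e).symm ≪≫ ((ℰ.baseChange z'').fibreBaseChangeIso g a').symm).hom := by
    simp only [fibreHom_comp, hfib, hu₂', Category.assoc, fibreHom_comp_alongStageIso_hom j z'' g y'' a a' hpt'' e 𝒞 ℰ h]
  -- Step 2: ★ (ν8) §1 (iv) at the families `(𝒜, ℰ)` for the post-composite
  have key := specialFibre_comp_lam_comp_dualIsogenyOver_eq_of_generic j z z'' g y y'' a a' hpt hpt'' e js ys ys'' b b' hspt hspt'' es 𝒜 ℰ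
    (U ≫ baseChangeHom (baseChangeHom h z'') g) u₂ hfib₂ D𝒜 pol𝒜 Dℰ polℰ n hlam
  -- Step 3: the special fibre of the post-composite, read through the special five-piece isomorphisms, is `ū ≫ h_{ys″}` (naturality at the special point)
  have nat' : fibreHom (baseChangeHom (baseChangeHom h z'') g) b' ≫ (ℰ.fibreBaseChangeIso js ys'' ≪≫ ℰ.fibreCongrPtIso hspt'' ≪≫ (ℰ.fibreBaseChangeIso z'' b).symm ≪≫ ((ℰ.baseChange z'').fibreCongrPtIso es).symm ≪≫ ((ℰ.baseChange z'').fibreBaseChangeIso g b').symm).inv =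
      (𝒞.fibreBaseChangeIso js ys'' ≪≫ 𝒞.fibreCongrPtIso hspt'' ≪≫ (𝒞.fibreBaseChangeIso z'' b).symm ≪≫ ((𝒞.baseChange z'').fibreCongrPtIso es).symm ≪≫ ((𝒞.baseChange z'').fibreBaseChangeIso g b').symm).inv ≫ fibreHom (baseChangeHom h js) ys'' := by
    rw [Iso.comp_inv_eq, Category.assoc, fibreHom_comp_alongStageIso_hom js z'' g ys'' b b' hspt'' es 𝒞 ℰ h, Iso.inv_hom_id_assoc]
  have hw' : ((𝒜.fibreBaseChangeIso js ys ≪≫ 𝒜.fibreCongrPtIso hspt ≪≫ (𝒜.fibreBaseChangeIso z b).symm ≪≫ ((𝒜.baseChange z).fibreCongrPtIso es).symm ≪≫ ((𝒜.baseChange z).fibreBaseChangeIso g b').symm).hom ≫ fibreHom (U ≫ baseChangeHom (baseChangeHom h z'') g) b' ≫ (ℰ.fibreBaseChangeIso js ys'' ≪≫ ℰ.fibreCongrPtIso hspt'' ≪≫ (ℰ.fibreBaseChangeIso z'' b).symm ≪≫ ((ℰ.baseChange z'').fibreCongrPtIso es).symm ≪≫ ((ℰ.baseChange z'').fibreBaseChangeIso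 g b').symm).inv).hom.hom.hom = w := by
    simp only [hw, fibreHom_comp, Category.assoc, nat', av_comp_hom_hom_hom', fibreHom_hom_hom_hom]
  rw [DualPair.dualIsogenyOver_congr ((D𝒜.baseChange js).baseChange ys) ((Dℰ.baseChange js).baseChange ys'') hw', hw'] at key
  exact key

end AbstractComp

section Head

/-! ### §2 The head: ★ (ν8) verbatim, with the fifth transfer (iv-h) -/

variable {K : Type} [Field K] [NumberField K] {v : HeightOneSpectrum (𝓞 K)} {Y : SchemeOver K}
  (𝓨 : IntegralModel (valuationSubringAtPrime K v) K Y) [IsProper 𝓨.total.hom]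
  (𝒜 𝒞 : AbelianSchemeOver 𝓨.total.left) (x x'' : AlgPoints Y (AlgebraicClosure (v.adicCompletion K)))

set_option maxHeartbeats 800000 in -- ★ (ν8)'s head runs at 400000; the fifth transfer is one more `exact` of the same size
/-- **THE SPECIAL FIBRE OF THE REDUCTION OF A HOMOMORPHISM BETWEEN FIBRE TUPLES, WITH ITS FOUR TRANSFERS AND THE POST-COMPOSITION TRANSFER.**  ★ (ν8)
`exists_specialFibre_hom_reduction` verbatim — `𝓨` a proper model at `v`, `𝒜, 𝒞 → 𝓨` abelian schemes, `x, x″ ∈ Y(Ω)`, `u : (𝒜_η)_x → (𝒞_η)_{x″}` a homomorphism; output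
`ū : (𝒜_s)_{x̄} → (𝒞_s)_{x̄″}` with (i) finite surjective ⇒ flat surjective, (ii) equivariance, (iii) section values, (iv) polarisation laws — PLUS **(iv-h)**: for every
`ℰ → 𝓨`, every homomorphism `h : 𝒞 → ℰ` over `𝓨`, every homomorphism `u₂` with `u₂ = u ≫ h_{x″}` (iterated base change of `h` along `ι_η` then `x″`), dual pairs and
polarisations `(D_𝒜, λ_𝒜)`, `(D_ℰ, λ_ℰ)` and `n` with `u₂ ≫ (λ_ℰ)_{x″} ≫ u₂^∨ = (λ_𝒜)_x ≫ [n]`, and every homomorphism `w` with `w = ū ≫ h_{x̄″}` (iterated base change of `h`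
along `ι_s` then `x̄″`): `w ≫ (λ_ℰ)_{x̄″} ≫ w^∨ = (λ_𝒜)_{x̄} ≫ [n]`.  (`u₂`, `w` are quantified with their defining equations so that no instance on a composite is needed at
the consumer.) [cite: SerreTate1968, §1] [cite: BoschLutkebohmertRaynaud1990, §1.2 Prop. 8 and §7.3 Prop. 6 (p. 180)]
[cite: MumfordFogartyKirwan1994, Ch. 6 §1 Corollary 6.2 (p. 116); Ch. 7 §2 Definition 7.2 (p. 129)] [cite: MumfordAV1970, §15 Thm. 1 (p. 143)] -/
theorem exists_specialFibre_hom_reduction_comp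
    (u : ((𝒜.baseChange (𝓨.genericIso'.inv.left ≫ pullback.fst 𝓨.total.hom (specGenericPoint (valuationSubringAtPrime K v) K))).baseChange x.left).X ⟶
         ((𝒞.baseChange (𝓨.genericIso'.inv.left ≫ pullback.fst 𝓨.total.hom (specGenericPoint (valuationSubringAtPrime K v) K))).baseChange x''.left).X)
    [IsMonHom u] :
    ∃ (ubar : ((𝒜.baseChange (pullback.fst 𝓨.total.hom (specResidueField v))).baseChange (𝓨.geomReductionMap x).left).X ⟶
               ((𝒞.baseChange (pullback.fst 𝓨.total.hom (specResidueField v))).baseChange (𝓨.geomReductionMap x'').left).X) (_ : IsMonHom ubar),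
      -- (i) finite surjective ⇒ flat surjective
      (IsFinite u.left → Surjective u.left → Flat ubar.left ∧ Function.Surjective ubar.left.base) ∧
      -- (ii) equivariance for endomorphism pairs transfers
      (∀ (f : 𝒜.X ⟶ 𝒜.X) (g : 𝒞.X ⟶ 𝒞.X) [IsMonHom f] [IsMonHom g],
        baseChangeHom (baseChangeHom f _) x.left ≫ u = u ≫ baseChangeHom (baseChangeHom g _) x''.left →
        baseChangeHom (baseChangeHom f (pullback.fst 𝓨.total.hom (specResidueField v))) (𝓨.geomReductionMap x).left ≫ ubar =
          ubar ≫ baseChangeHom (baseChangeHom g (pullback.fst 𝓨.total.hom (specResidueField v))) (𝓨.geomReductionMap x'').left) ∧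
      -- (iii) identities of section values transfer
      (∀ (τ : 𝒜.Sections) (τ'' : 𝒞.Sections),
        AlgPoints.map u ((𝒜.baseChange _).restrictPt x.left (𝒜.sectionBaseChange _ τ)) =
          (𝒞.baseChange _).restrictPt x''.left (𝒞.sectionBaseChange _ τ'') →
        AlgPoints.map ubar ((𝒜.baseChange (pullback.fst 𝓨.total.hom (specResidueField v))).restrictPt (𝓨.geomReductionMap x).left
            (𝒜.sectionBaseChange _ τ)) =
          (𝒞.baseChange (pullback.fst 𝓨.total.hom (specResidueField v))).restrictPt (𝓨.geomReductionMap x'').left (𝒞.sectionBaseChange _ τ'')) ∧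
      -- (iv) a polarisation law in dual-homomorphism form transfers
      (∀ (D𝒜 : 𝒜.DualPair) (pol𝒜 : 𝒜.Polarization D𝒜) (D𝒞 : 𝒞.DualPair) (pol𝒞 : 𝒞.Polarization D𝒞) (n : ℕ),
        u ≫ ((pol𝒞.baseChange _).baseChange x''.left).lam ≫ DualPair.dualIsogenyOver u ((D𝒜.baseChange _).baseChange x.left) ((D𝒞.baseChange _).baseChange x''.left) =
          ((pol𝒜.baseChange _).baseChange x.left).lam ≫ ((D𝒜.baseChange _).baseChange x.left).hat.mulN n →
        ubar ≫ ((pol𝒞.baseChange (pullback.fst 𝓨.total.hom (specResidueField v))).baseChange (𝓨.geomReductionMap x'').left).lam ≫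
            DualPair.dualIsogenyOver ubar ((D𝒜.baseChange (pullback.fst 𝓨.total.hom (specResidueField v))).baseChange (𝓨.geomReductionMap x).left)
              ((D𝒞.baseChange (pullback.fst 𝓨.total.hom (specResidueField v))).baseChange (𝓨.geomReductionMap x'').left) =
          ((pol𝒜.baseChange (pullback.fst 𝓨.total.hom (specResidueField v))).baseChange (𝓨.geomReductionMap x).left).lam ≫
            ((D𝒜.baseChange (pullback.fst 𝓨.total.hom (specResidueField v))).baseChange (𝓨.geomReductionMap x).left).hat.mulN n) ∧
      -- (iv-h) the polarisation law of a POST-COMPOSITE `u ≫ h_{x″}` with a MODEL homomorphism `h : 𝒞 → ℰ` transfers to `ū ≫ h_{x̄″}` (this file)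
      (∀ (ℰ : AbelianSchemeOver 𝓨.total.left) (h : 𝒞.X ⟶ ℰ.X) [IsMonHom h]
        (u₂ : ((𝒜.baseChange (𝓨.genericIso'.inv.left ≫ pullback.fst 𝓨.total.hom (specGenericPoint (valuationSubringAtPrime K v) K))).baseChange x.left).X ⟶
          ((ℰ.baseChange (𝓨.genericIso'.inv.left ≫ pullback.fst 𝓨.total.hom (specGenericPoint (valuationSubringAtPrime K v) K))).baseChange x''.left).X) [IsMonHom u₂],
        u₂ = u ≫ baseChangeHom (baseChangeHom h (𝓨.genericIso'.inv.left ≫ pullback.fst 𝓨.total.hom (specGenericPoint (valuationSubringAtPrime K v) K))) x''.left →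
        ∀ (D𝒜 : 𝒜.DualPair) (pol𝒜 : 𝒜.Polarization D𝒜) (Dℰ : ℰ.DualPair) (polℰ : ℰ.Polarization Dℰ) (n : ℕ),
        u₂ ≫ ((polℰ.baseChange (𝓨.genericIso'.inv.left ≫ pullback.fst 𝓨.total.hom (specGenericPoint (valuationSubringAtPrime K v) K))).baseChange x''.left).lam ≫
            DualPair.dualIsogenyOver u₂ ((D𝒜.baseChange (𝓨.genericIso'.inv.left ≫ pullback.fst 𝓨.total.hom (specGenericPoint (valuationSubringAtPrime K v) K))).baseChange x.left) ((Dℰ.baseChange (𝓨.genericIso'.inv.left ≫ pullback.fst 𝓨.total.hom (specGenericPoint (valuationSubringAtPrime K v) K))).baseChange x''.left) =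
          ((pol𝒜.baseChange (𝓨.genericIso'.inv.left ≫ pullback.fst 𝓨.total.hom (specGenericPoint (valuationSubringAtPrime K v) K))).baseChange x.left).lam ≫ ((D𝒜.baseChange (𝓨.genericIso'.inv.left ≫ pullback.fst 𝓨.total.hom (specGenericPoint (valuationSubringAtPrime K v) K))).baseChange x.left).hat.mulN n →
        ∀ (w : ((𝒜.baseChange (pullback.fst 𝓨.total.hom (specResidueField v))).baseChange (𝓨.geomReductionMap x).left).X ⟶
          ((ℰ.baseChange (pullback.fst 𝓨.total.hom (specResidueField v))).baseChange (𝓨.geomReductionMap x'').left).X) [IsMonHom w],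
        w = ubar ≫ baseChangeHom (baseChangeHom h (pullback.fst 𝓨.total.hom (specResidueField v))) (𝓨.geomReductionMap x'').left →
        w ≫ ((polℰ.baseChange (pullback.fst 𝓨.total.hom (specResidueField v))).baseChange (𝓨.geomReductionMap x'').left).lam ≫
            DualPair.dualIsogenyOver w ((D𝒜.baseChange (pullback.fst 𝓨.total.hom (specResidueField v))).baseChange (𝓨.geomReductionMap x).left) ((Dℰ.baseChange (pullback.fst 𝓨.total.hom (specResidueField v))).baseChange (𝓨.geomReductionMap x'').left) =
          ((pol𝒜.baseChange (pullback.fst 𝓨.total.hom (specResidueField v))).baseChange (𝓨.geomReductionMap x).left).lam ≫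
            ((D𝒜.baseChange (pullback.fst 𝓨.total.hom (specResidueField v))).baseChange (𝓨.geomReductionMap x).left).hat.mulN n) := by
  -- the homomorphism of abelian varieties underlying `u`, and the TURNKEY reduction ★ (ν7)
  obtain ⟨D, _i1, _i2, L, _i3, _i4, _i5, _i6, _i7, _i8, gD, h, hh, hgD, ha, z, z'', hz, hz'', L', _j1, _j2, _j3, _j4, _j5, χ, h', U, hU,
      hpt, hpt'', e, hspt, hspt'', et, hχ, hh', hh'h, hDed, hFrac, hfib, huniq, hisog⟩ :=
    exists_stage_hom_reduction_turnkey 𝓨 𝒜 𝒞 x x'' (homOfIsMonHom u)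
  haveI := hDed
  haveI := hFrac
  haveI := hU
  -- injectivity of restriction to the `Ω`-point `ξ′` of the refined stage (schematically dominant: `D′ → Ω` injective)
  have h'inj : Function.Injective h' := by
    intro a b hab
    have h1 : χ (a : L') = χ (b : L') := by rw [← hh', ← hh', hab]
    exact Subtype.ext (hχ h1)
  haveI : IsDominant (specGenericPoint (closureValuationSubring (v.adicCompletion K)) (AlgebraicClosure (v.adicCompletion K)) ≫ Spec.map (CommRingCat.ofHom h')) := by
    haveI := isDominant_specMap_of_injective
      (algebraMap (closureValuationSubring (v.adicCompletion K)) (AlgebraicClosure (v.adicCompletion K))) Subtype.val_injective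
    haveI := isDominant_specMap_of_injective h' h'inj
    infer_instance
  haveI : IsSchemeTheoreticallyDominant (specGenericPoint (closureValuationSubring (v.adicCompletion K)) (AlgebraicClosure (v.adicCompletion K)) ≫ Spec.map (CommRingCat.ofHom h')) := IsSchemeTheoreticallyDominant.of_isDominant _
  -- the special fibre of `U`, transported along the special five-piece along-stage isomorphisms (★ (ν6) §1 shape at `j := ι_s`, `y := x̄`, `a := cp ≫ Spec h`,
  -- `a′ := t′ := cp ≫ Spec h′`, `hpt := hspt`, `e := et`; `cp : Spec κ̄ → Spec R` the geometric closed point of `R`): `ū := E_𝒜 ≫ U_{t′} ≫ E_𝒞⁻¹`, written literally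
  refine ⟨((𝒜.fibreBaseChangeIso (pullback.fst 𝓨.total.hom (specResidueField v)) (𝓨.geomReductionMap x).left ≪≫ 𝒜.fibreCongrPtIso hspt ≪≫ (𝒜.fibreBaseChangeIso z.left (((geomClosedPointIsoSpecResidueField v).inv.left ≫ (specRingHomι (closureValuationSubring (v.adicCompletion K)) (toClosureValuationSubring v) (IsLocalRing.residue (closureValuationSubring (v.adicCompletion K)))).left) ≫ Spec.map (CommRingCat.ofHom h))).symm ≪≫ ((𝒜.baseChange z.left).fibreCongrPtIso et).symm ≪≫ ((𝒜.baseChange z.left).fibreBaseChangeIso (Spec.map (CommRingCat.ofHom (algebraMap D (integralClosure D L')))) (((geomClosedPointIsoSpecResidueField v).inv.left ≫ (specRingHomι (closureValuationSubring (v.adicCompletion K)) (toClosureValuationSubring v) (IsLocalRing.residue (closureValuationSubring (v.adicCompletion K)))).left) ≫ Spec.map (CommRingCat.ofHom h'))).symm).hom ≫ fibreHom U (((geomClosedPointIsoSpecResidueField v).inv.left ≫ (specRingHomι (closureValuationSubring (v.adicCompletion K)) (toClosureValuationSubring v) (IsLocalRing.residue (closureValuationSubring (v.adicCompletion K)))).left)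 ≫ Spec.map (CommRingCat.ofHom h')) ≫ (𝒞.fibreBaseChangeIso (pullback.fst 𝓨.total.hom (specResidueField v)) (𝓨.geomReductionMap x'').left ≪≫ 𝒞.fibreCongrPtIso hspt'' ≪≫ (𝒞.fibreBaseChangeIso z''.left (((geomClosedPointIsoSpecResidueField v).inv.left ≫ (specRingHomι (closureValuationSubring (v.adicCompletion K)) (toClosureValuationSubring v) (IsLocalRing.residue (closureValuationSubring (v.adicCompletion K)))).left) ≫ Spec.map (CommRingCat.ofHom h))).symm ≪≫ ((𝒞.baseChange z''.left).fibreCongrPtIso et).symm ≪≫ ((𝒞.baseChange z''.left).fibreBaseChangeIso (Spec.map (CommRingCat.ofHom (algebraMap D (integralClosure D L')))) (((geomClosedPointIsoSpecResidueField v).inv.left ≫ (specRingHomι (closureValuationSubring (v.adicCompletion K)) (toClosureValuationSubring v) (IsLocalRing.residue (closureValuationSubring (v.adicCompletion K)))).left) ≫ Spec.map (CommRingCat.ofHom h'))).symm).inv).hom.hom.hom,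
    ((𝒜.fibreBaseChangeIso (pullback.fst 𝓨.total.hom (specResidueField v)) (𝓨.geomReductionMap x).left ≪≫ 𝒜.fibreCongrPtIso hspt ≪≫ (𝒜.fibreBaseChangeIso z.left (((geomClosedPointIsoSpecResidueField v).inv.left ≫ (specRingHomι (closureValuationSubring (v.adicCompletion K)) (toClosureValuationSubring v) (IsLocalRing.residue (closureValuationSubring (v.adicCompletion K)))).left) ≫ Spec.map (CommRingCat.ofHom h))).symm ≪≫ ((𝒜.baseChange z.left).fibreCongrPtIso et).symm ≪≫ ((𝒜.baseChange z.left).fibreBaseChangeIso (Spec.map (CommRingCat.ofHom (algebraMap D (integralClosure D L')))) (((geomClosedPointIsoSpecResidueField v).inv.left ≫ (specRingHomι (closureValuationSubring (v.adicCompletion K)) (toClosureValuationSubring v) (IsLocalRing.residue (closureValuationSubring (v.adicCompletion K)))).left) ≫ Spec.map (CommRingCat.ofHom h'))).symm).hom ≫ fibreHom U (((geomClosedPointIsoSpecResidueField v).inv.left ≫ (specRingHomι (closureValuationSubring (v.adicCompletion K)) (toClosureValuationSubring v) (IsLocalRing.residue (closureValuationSubring (v.adicCompletion K)))).left) ≫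 Spec.map (CommRingCat.ofHom h')) ≫ (𝒞.fibreBaseChangeIso (pullback.fst 𝓨.total.hom (specResidueField v)) (𝓨.geomReductionMap x'').left ≪≫ 𝒞.fibreCongrPtIso hspt'' ≪≫ (𝒞.fibreBaseChangeIso z''.left (((geomClosedPointIsoSpecResidueField v).inv.left ≫ (specRingHomι (closureValuationSubring (v.adicCompletion K)) (toClosureValuationSubring v) (IsLocalRing.residue (closureValuationSubring (v.adicCompletion K)))).left) ≫ Spec.map (CommRingCat.ofHom h))).symm ≪≫ ((𝒞.baseChange z''.left).fibreCongrPtIso et).symm ≪≫ ((𝒞.baseChange z''.left).fibreBaseChangeIso (Spec.map (CommRingCat.ofHom (algebraMap D (integralClosure D L')))) (((geomClosedPointIsoSpecResidueField v).inv.left ≫ (specRingHomι (closureValuationSubring (v.adicCompletion K)) (toClosureValuationSubring v) (IsLocalRing.residue (closureValuationSubring (v.adicCompletion K)))).left) ≫ Spec.map (CommRingCat.ofHom h'))).symm).inv).hom.hom.isMonHom_hom, ?_, ?_, ?_, ?_, ?_⟩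
  · -- (i) finite surjective ⇒ flat surjective: `u` is an isogeny ⇒ (★ (ν7)) `U_{t′}` is ⇒ `ū` is (★ `isIsogeny_hom_comp_iso`) ⇒ flat (★ `IsIsogeny.flat`)
    intro hfin hsurj
    have hu : AbelianVariety.IsIsogeny (homOfIsMonHom u) := ⟨hsurj, hfin⟩
    have hub : AbelianVariety.IsIsogeny ((𝒜.fibreBaseChangeIso (pullback.fst 𝓨.total.hom (specResidueField v)) (𝓨.geomReductionMap x).left ≪≫ 𝒜.fibreCongrPtIso hspt ≪≫ (𝒜.fibreBaseChangeIso z.left (((geomClosedPointIsoSpecResidueField v).inv.left ≫ (specRingHomι (closureValuationSubring (v.adicCompletion K)) (toClosureValuationSubring v) (IsLocalRing.residue (closureValuationSubring (v.adicCompletion K)))).left) ≫ Spec.map (CommRingCat.ofHom h))).symm ≪≫ ((𝒜.baseChange z.left).fibreCongrPtIso et).symm ≪≫ ((𝒜.baseChange z.left).fibreBaseChangeIso (Spec.map (CommRingCat.ofHom (algebraMap D (integralClosure D L')))) (((geomClosedPointIsoSpecResidueField v).inv.left ≫ (specRingHomι (closureValuationSubring (v.adicCompletion K)) (toClosureValuationSubring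 v) (IsLocalRing.residue (closureValuationSubring (v.adicCompletion K)))).left) ≫ Spec.map (CommRingCat.ofHom h'))).symm).hom ≫ fibreHom U (((geomClosedPointIsoSpecResidueField v).inv.left ≫ (specRingHomι (closureValuationSubring (v.adicCompletion K)) (toClosureValuationSubring v) (IsLocalRing.residue (closureValuationSubring (v.adicCompletion K)))).left) ≫ Spec.map (CommRingCat.ofHom h')) ≫ (𝒞.fibreBaseChangeIso (pullback.fst 𝓨.total.hom (specResidueField v)) (𝓨.geomReductionMap x'').left ≪≫ 𝒞.fibreCongrPtIso hspt'' ≪≫ (𝒞.fibreBaseChangeIso z''.left (((geomClosedPointIsoSpecResidueField v).inv.left ≫ (specRingHomι (closureValuationSubring (v.adicCompletion K)) (toClosureValuationSubring v) (IsLocalRing.residue (closureValuationSubring (v.adicCompletion K)))).left) ≫ Spec.map (CommRingCat.ofHom h))).symm ≪≫ ((𝒞.baseChange z''.left).fibreCongrPtIso et).symm ≪≫ ((𝒞.baseChange z''.left).fibreBaseChangeIso (Spec.map (CommRingCat.ofHom (algebraMap D (integralClosure D L')))) (((geomClosedPointIsoSpecResidueField v).inv.left ≫ (specRingHomι (closureValuationSubring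 (v.adicCompletion K)) (toClosureValuationSubring v) (IsLocalRing.residue (closureValuationSubring (v.adicCompletion K)))).left) ≫ Spec.map (CommRingCat.ofHom h'))).symm).inv) :=
      isIsogeny_hom_comp_iso (𝒜.fibreBaseChangeIso (pullback.fst 𝓨.total.hom (specResidueField v)) (𝓨.geomReductionMap x).left ≪≫ 𝒜.fibreCongrPtIso hspt ≪≫ (𝒜.fibreBaseChangeIso z.left (((geomClosedPointIsoSpecResidueField v).inv.left ≫ (specRingHomι (closureValuationSubring (v.adicCompletion K)) (toClosureValuationSubring v) (IsLocalRing.residue (closureValuationSubring (v.adicCompletion K)))).left) ≫ Spec.map (CommRingCat.ofHom h))).symm ≪≫ ((𝒜.baseChange z.left).fibreCongrPtIso et).symm ≪≫ ((𝒜.baseChange z.left).fibreBaseChangeIso (Spec.map (CommRingCat.ofHom (algebraMap D (integralClosure D L')))) (((geomClosedPointIsoSpecResidueField v).inv.left ≫ (specRingHomι (closureValuationSubring (v.adicCompletion K)) (toClosureValuationSubring v) (IsLocalRing.residue (closureValuationSubring (v.adicCompletion K)))).left) ≫ Spec.map (CommRingCat.ofHom h'))).symm) (fibreHom U (((geomClosedPointIsoSpecResidueField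 v).inv.left ≫ (specRingHomι (closureValuationSubring (v.adicCompletion K)) (toClosureValuationSubring v) (IsLocalRing.residue (closureValuationSubring (v.adicCompletion K)))).left) ≫ Spec.map (CommRingCat.ofHom h'))) (𝒞.fibreBaseChangeIso (pullback.fst 𝓨.total.hom (specResidueField v)) (𝓨.geomReductionMap x'').left ≪≫ 𝒞.fibreCongrPtIso hspt'' ≪≫ (𝒞.fibreBaseChangeIso z''.left (((geomClosedPointIsoSpecResidueField v).inv.left ≫ (specRingHomι (closureValuationSubring (v.adicCompletion K)) (toClosureValuationSubring v) (IsLocalRing.residue (closureValuationSubring (v.adicCompletion K)))).left) ≫ Spec.map (CommRingCat.ofHom h))).symm ≪≫ ((𝒞.baseChange z''.left).fibreCongrPtIso et).symm ≪≫ ((𝒞.baseChange z''.left).fibreBaseChangeIso (Spec.map (CommRingCat.ofHom (algebraMap D (integralClosure D L')))) (((geomClosedPointIsoSpecResidueField v).inv.left ≫ (specRingHomι (closureValuationSubring (v.adicCompletion K)) (toClosureValuationSubring v) (IsLocalRing.residue (closureValuationSubring (v.adicCompletion K)))).left) ≫ Spec.map (CommRingCat.ofHom h'))).symm).symm (hisog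 hu (((geomClosedPointIsoSpecResidueField v).inv.left ≫ (specRingHomι (closureValuationSubring (v.adicCompletion K)) (toClosureValuationSubring v) (IsLocalRing.residue (closureValuationSubring (v.adicCompletion K)))).left) ≫ Spec.map (CommRingCat.ofHom h')))
    exact ⟨hub.flat, hub.1.surj⟩
  · -- (ii) equivariance transfers (§1 `baseChangeHom_comp_specialFibre_eq_of_generic` at the turnkey's two stages)
    intro f g hf hg hfg
    exact baseChangeHom_comp_specialFibre_eq_of_generic (𝓨.genericIso'.inv.left ≫ pullback.fst 𝓨.total.hom (specGenericPoint (valuationSubringAtPrime K v) K)) z.left z''.left (Spec.map (CommRingCat.ofHom (algebraMap D (integralClosure D L')))) x.left x''.left (specGenericPoint (closureValuationSubring (v.adicCompletion K)) (AlgebraicClosure (v.adicCompletion K)) ≫ Spec.map (CommRingCat.ofHom h)) (specGenericPoint (closureValuationSubring (v.adicCompletion K)) (AlgebraicClosure (v.adicCompletion K)) ≫ Spec.map (CommRingCat.ofHom h')) hpt hpt'' e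
      (pullback.fst 𝓨.total.hom (specResidueField v)) (𝓨.geomReductionMap x).left (𝓨.geomReductionMap x'').left (((geomClosedPointIsoSpecResidueField v).inv.left ≫ (specRingHomι (closureValuationSubring (v.adicCompletion K)) (toClosureValuationSubring v) (IsLocalRing.residue (closureValuationSubring (v.adicCompletion K)))).left) ≫ Spec.map (CommRingCat.ofHom h)) (((geomClosedPointIsoSpecResidueField v).inv.left ≫ (specRingHomι (closureValuationSubring (v.adicCompletion K)) (toClosureValuationSubring v) (IsLocalRing.residue (closureValuationSubring (v.adicCompletion K)))).left) ≫ Spec.map (CommRingCat.ofHom h')) hspt hspt'' et 𝒜 𝒞 U u hfib f g hfg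
  · -- (iii) section values transfer (§1 `map_specialFibre_restrictPt_eq_of_generic`)
    intro τ τ'' hτ
    exact map_specialFibre_restrictPt_eq_of_generic (𝓨.genericIso'.inv.left ≫ pullback.fst 𝓨.total.hom (specGenericPoint (valuationSubringAtPrime K v) K)) z.left z''.left (Spec.map (CommRingCat.ofHom (algebraMap D (integralClosure D L')))) x.left x''.left (specGenericPoint (closureValuationSubring (v.adicCompletion K)) (AlgebraicClosure (v.adicCompletion K)) ≫ Spec.map (CommRingCat.ofHom h)) (specGenericPoint (closureValuationSubring (v.adicCompletion K)) (AlgebraicClosure (v.adicCompletion K)) ≫ Spec.map (CommRingCat.ofHom h')) hpt hpt'' e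
      (pullback.fst 𝓨.total.hom (specResidueField v)) (𝓨.geomReductionMap x).left (𝓨.geomReductionMap x'').left (((geomClosedPointIsoSpecResidueField v).inv.left ≫ (specRingHomι (closureValuationSubring (v.adicCompletion K)) (toClosureValuationSubring v) (IsLocalRing.residue (closureValuationSubring (v.adicCompletion K)))).left) ≫ Spec.map (CommRingCat.ofHom h)) (((geomClosedPointIsoSpecResidueField v).inv.left ≫ (specRingHomι (closureValuationSubring (v.adicCompletion K)) (toClosureValuationSubring v) (IsLocalRing.residue (closureValuationSubring (v.adicCompletion K)))).left) ≫ Spec.map (CommRingCat.ofHom h')) hspt hspt'' et 𝒜 𝒞 U u hfib τ τ'' hτ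
  · -- (iv) the polarisation law transfers (§1 `specialFibre_comp_lam_comp_dualIsogenyOver_eq_of_generic`; the refined stage `Spec D′` is connected, reduced, Noetherian)
    intro D𝒜 pol𝒜 D𝒞 pol𝒞 n hlam
    haveI : IsNoetherianRing (integralClosure D L') := inferInstance
    exact specialFibre_comp_lam_comp_dualIsogenyOver_eq_of_generic (𝓨.genericIso'.inv.left ≫ pullback.fst 𝓨.total.hom (specGenericPoint (valuationSubringAtPrime K v) K)) z.left z''.left (Spec.map (CommRingCat.ofHom (algebraMap D (integralClosure D L')))) x.left x''.left (specGenericPoint (closureValuationSubring (v.adicCompletion K)) (AlgebraicClosure (v.adicCompletion K)) ≫ Spec.map (CommRingCat.ofHom h)) (specGenericPoint (closureValuationSubring (v.adicCompletion K)) (AlgebraicClosure (v.adicCompletion K)) ≫ Spec.map (CommRingCat.ofHom h')) hpt hpt'' e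
      (pullback.fst 𝓨.total.hom (specResidueField v)) (𝓨.geomReductionMap x).left (𝓨.geomReductionMap x'').left (((geomClosedPointIsoSpecResidueField v).inv.left ≫ (specRingHomι (closureValuationSubring (v.adicCompletion K)) (toClosureValuationSubring v) (IsLocalRing.residue (closureValuationSubring (v.adicCompletion K)))).left) ≫ Spec.map (CommRingCat.ofHom h)) (((geomClosedPointIsoSpecResidueField v).inv.left ≫ (specRingHomι (closureValuationSubring (v.adicCompletion K)) (toClosureValuationSubring v) (IsLocalRing.residue (closureValuationSubring (v.adicCompletion K)))).left) ≫ Spec.map (CommRingCat.ofHom h')) hspt hspt'' et 𝒜 𝒞 U u hfib D𝒜 pol𝒜 D𝒞 pol𝒞 n hlam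
  · -- (iv-h) the post-composite (§1 `specialFibre_postcomp_comp_lam_comp_dualIsogenyOver_eq_of_generic`)
    intro ℰ hm _ u₂ _ hu₂eq D𝒜 pol𝒜 Dℰ polℰ n hlam w _ hweq
    haveI : IsNoetherianRing (integralClosure D L') := inferInstance
    exact specialFibre_postcomp_comp_lam_comp_dualIsogenyOver_eq_of_generic (𝓨.genericIso'.inv.left ≫ pullback.fst 𝓨.total.hom (specGenericPoint (valuationSubringAtPrime K v) K)) z.left z''.left (Spec.map (CommRingCat.ofHom (algebraMap D (integralClosure D L')))) x.left x''.left (specGenericPoint (closureValuationSubring (v.adicCompletion K)) (AlgebraicClosure (v.adicCompletion K)) ≫ Spec.map (CommRingCat.ofHom h)) (specGenericPoint (closureValuationSubring (v.adicCompletion K)) (AlgebraicClosure (v.adicCompletion K)) ≫ Spec.map (CommRingCat.ofHom h')) hpt hpt'' e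
      (pullback.fst 𝓨.total.hom (specResidueField v)) (𝓨.geomReductionMap x).left (𝓨.geomReductionMap x'').left (((geomClosedPointIsoSpecResidueField v).inv.left ≫ (specRingHomι (closureValuationSubring (v.adicCompletion K)) (toClosureValuationSubring v) (IsLocalRing.residue (closureValuationSubring (v.adicCompletion K)))).left) ≫ Spec.map (CommRingCat.ofHom h)) (((geomClosedPointIsoSpecResidueField v).inv.left ≫ (specRingHomι (closureValuationSubring (v.adicCompletion K)) (toClosureValuationSubring v) (IsLocalRing.residue (closureValuationSubring (v.adicCompletion K)))).left) ≫ Spec.map (CommRingCat.ofHom h')) hspt hspt'' et 𝒜 𝒞 U u hfib ℰ hm D𝒜 pol𝒜 Dℰ polℰ n u₂ hu₂eq hlam w hweq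

end Head

end AbelianSchemeOver

end Literature.AlgebraicGeometry.AbelianSchemes

end
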